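import Literature.AlgebraicGeometry.GroupSchemes.BTGroupNilpotentPoints   -- ★ `BTGroup`, `BTGroup.Hom`, `IsRingActionBT` (+ `map_one ∕ map_mul ∕ app_add' ∕ app_neg`)
import Mathlib.RingTheory.DiscreteValuationRing.Basic
import Mathlib.SetTheory.Cardinal.Finite
import HarnessLib

/-!
# The stable subgroups of the points of a `[ϖ]`-layer are `⊥` and `⊤` (a line over the residue field)

Topic `Literature/AlgebraicGeometry/GroupSchemes`; namespace `Literature.AlgebraicGeometry.GroupSchemes.StableSubgroupsOfPoints`.  THEOREMS ONLY
(no definition, no instance, no notation, no named fact, no `sorry`).  Cell `hodgecm-mathlib` (D-0151), programme P6 «MOD» (crux hLiu418 =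
stmt-HodgeConjecture-24832, `--supports`, count-neutral): organ **(N6) «SIMPLE POINTS»** of the P6b sub-line «ONE-DIMENSIONAL BLOCK NUMERICS»
(`Cruxes/HLiu418/Lines/F0_P6b_BlockNumerics.lean`, desk F0P6b-plan (g2), cand v1 49deda72 :175–:191): it PAYS the registered stub
`stub_N6_simplePoints` BY NAME (same binders in the same order, minus the unused `ϖ ∕ hϖ ∕ hker`, `[IsAlgClosed k]`, `[IsAffine G.left]`,
`[IsFinite G.hom]`, `[Finite (ResidueField 𝒪)]`, and `IsDiscreteValuationRing` weakened to `IsLocalRing`), i.e. the binder `hsimple` of P6c's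
`heart_of_constructors`.  HC_CM is proved only modulo the printed citations
until rung 0 closes; this file is generic and changes no count.

THE PRINT ([HarrisTaylorAMS2001] §II.2; [Tate1967] §2.2; [Liu2021] Prop. D.8 (proof), p. 136).  Let `B` be a Barsotti–Tate group over a field `k` with a ring action
`β` of a discrete valuation ring `𝒪` (uniformiser `ϖ`, residue field `κ = 𝒪⧸ϖ` of cardinality `q = p^f`), and `G = Ker (β ϖ)|_{B[p]} ↪ B[p]` the
`[ϖ]`-layer, given as a closed subgroup `ιG` through which exactly the points killed by `β(ϖ)` factor.  The points `G(k) = Hom(Spec k, G)` form an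
`𝒪`-module (`r • g := g ≫ β(r)`, additive because `β` is a RING action, ★ `IsRingActionBT`) killed by `ϖ`, i.e. a `κ`-vector space; if `#G(k) = q`
it is a `κ`-LINE, so a subgroup `Λ ⊆ G(k)` stable under the action (of any family `βG a` of endomorphisms of `G` lifting `β(ρ a)` with the residues of
the `ρ a` exhausting `κ`) is `0` or everything: for `g ∈ Λ ∖ {1}` the orbit map `κ → G(k)`, `c ↦ (ρ a with residue c) • g`, is well defined (two lifts
differ by an element of `(ϖ)`, which acts trivially), lands in `Λ`, is injective (if `u • g = 1` with `u` a unit then `g = u⁻¹ • (u • g) = 1`), hence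
bijective (`#κ = q = #G(k)`), so `Λ = G(k)`.  If `#G(k) = 1` every subgroup is `⊥`.  (In the application `B = 𝒢_x̄` is the one-dimensional block
of the universal abelian scheme at a special point, `#G(κ̄) ∈ {1, q}` the supersingular ∕ ordinary dichotomy, `βG` the `𝒪_F`-action.)

## Contents (`B : BTGroup (Spec k) p H`, `β : 𝒪 → BTGroup.Hom B B` with `IsRingActionBT B β`; points `t : 𝟙_ ⟶ B.G 1`, `g : 𝟙_ ⟶ G`)
* §1 THE MODULE IDENTITIES ON POINTS: `comp_app_add` ∕ `comp_app_neg` ∕ `comp_app_sub` ∕ `comp_app_mul` ∕ `comp_app_one` (the action `r • t := t ≫ (β r)₁`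
  is additive in `r`, multiplicative, unital);
* §2 THE `[ϖ]`-LAYER: `comp_ιG_comp_app_eq_one` (its points are killed by `β ϖ`), `comp_ιG_comp_app_eq_one_of_mem_maximalIdeal` (hence by the whole
  maximal ideal `(ϖ)` of the DVR), **`comp_ιG_comp_app_eq_of_residue_eq`** (the action on them FACTORS THROUGH THE RESIDUE FIELD),
  **`eq_one_of_isUnit_of_comp_app_eq_one`** (a unit acting trivially on `g` forces `g = 1`);
* §3 **`subgroup_eq_bot_or_eq_top_of_stable`** — `stub_N6_simplePoints` with its binders in order MINUS `ϖ ∕ hϖ ∕ hker` (not needed: the orbit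
  map through a section of the residues is injective for ANY closed subgroup `G ↪ B.G 1` with a lifted action) and over any LOCAL ring `𝒪`:
  `#G(k) ∈ {1, p^f} = {1, #κ}` ⇒ every subgroup of `G(k)` stable under all `βG a` is `⊥` or `⊤`.

## References
* [HarrisTaylorAMS2001] M. Harris, R. Taylor, *The geometry and cohomology of some simple Shimura varieties* (2001) — §II.1 p. 59, §II.2.
* [Tate1967] J. Tate, *p-divisible groups*, Proc. Conf. Local Fields (Driebergen, 1966), Springer 1967 — §2.2, (2.4).
* [Liu2021] Y. Liu, *Fourier–Jacobi cycles and arithmetic relative trace formula* (with an appendix by C. Li and Y. Zhu), arXiv:2102.11518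
  (2021) — Appendix D, Prop. D.8 (proof), p. 136.
-/

set_option autoImplicit false

-- Mathlib's `Over`/`Scheme` APIs and the layers' group structures (`letI := B.grpObj n`) are stated across semireducible wrappers
-- (as in ★ `GroupSchemes/*`).
set_option backward.isDefEq.respectTransparency false

noncomputable section

open CategoryTheory CategoryTheory.Limits AlgebraicGeometry MonoidalCategory CartesianMonoidalCategory

open scoped MonObj

universe u v w

namespace Literature.AlgebraicGeometry.GroupSchemes.StableSubgroupsOfPoints

open Literature.AlgebraicGeometry.Motives (SchemeOver)
open Literature.AlgebraicGeometry.GroupSchemes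

variable {k : Type u} [Field k] {p H : ℕ} {B : BTGroup (Spec (.of k)) p H}
variable {𝒪 : Type v} [CommRing 𝒪] {β : 𝒪 → BTGroup.Hom B B}

/-! ## §1 The module identities for the action `r • t := t ≫ (β r).app 1` on points of the first layer -/

/-- ADDITIVITY: `t ≫ β(x + y)₁ = (t ≫ β(x)₁) · (t ≫ β(y)₁)` in the group of points of `B.G 1` (★ `IsRingActionBT.app_add'`, Mathlib `MonObj.comp_mul`).
[cite: Tate1967, §2.2] -/
theorem comp_app_add (hβ : IsRingActionBT B β) {T : SchemeOver k} (t : T ⟶ B.G 1) (x y : 𝒪) :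
    letI := B.grpObj 1; t ≫ (β (x + y)).app 1 = (t ≫ (β x).app 1) * (t ≫ (β y).app 1) := by
  letI := B.grpObj 1
  rw [hβ.app_add' x y 1, MonObj.comp_mul]

/-- `t ≫ β(−x)₁ = (t ≫ β(x)₁)⁻¹` (★ `IsRingActionBT.app_neg`, Mathlib `GrpObj.comp_inv`). [cite: Tate1967, §2.2] -/
theorem comp_app_neg (hβ : IsRingActionBT B β) {T : SchemeOver k} (t : T ⟶ B.G 1) (x : 𝒪) :
    letI := B.grpObj 1; t ≫ (β (-x)).app 1 = (t ≫ (β x).app 1)⁻¹ := by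
  letI := B.grpObj 1
  rw [hβ.app_neg x 1, GrpObj.comp_inv]

/-- `t ≫ β(x − y)₁ = (t ≫ β(x)₁) · (t ≫ β(y)₁)⁻¹`. [cite: Tate1967, §2.2] -/
theorem comp_app_sub (hβ : IsRingActionBT B β) {T : SchemeOver k} (t : T ⟶ B.G 1) (x y : 𝒪) :
    letI := B.grpObj 1; t ≫ (β (x - y)).app 1 = (t ≫ (β x).app 1) * (t ≫ (β y).app 1)⁻¹ := by
  letI := B.grpObj 1
  rw [sub_eq_add_neg, comp_app_add hβ, comp_app_neg hβ]

/-- MULTIPLICATIVITY: `t ≫ β(x·y)₁ = (t ≫ β(y)₁) ≫ β(x)₁` (★ `IsRingActionBT.map_mul`: `β (x y) = β y` followed by `β x`). [cite: Tate1967, §2.2] -/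
theorem comp_app_mul (hβ : IsRingActionBT B β) {T : SchemeOver k} (t : T ⟶ B.G 1) (x y : 𝒪) :
    t ≫ (β (x * y)).app 1 = (t ≫ (β y).app 1) ≫ (β x).app 1 := by
  rw [hβ.map_mul, BTGroup.Hom.comp_app, Category.assoc]

/-- UNIT: `t ≫ β(1)₁ = t`. [cite: Tate1967, §2.2] -/
theorem comp_app_one (hβ : IsRingActionBT B β) {T : SchemeOver k} (t : T ⟶ B.G 1) : t ≫ (β 1).app 1 = t := by
  rw [hβ.app_one, Category.comp_id]

/-! ## §2 The `[ϖ]`-layer: its points are an `𝒪⧸ϖ`-module -/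

section Layer

variable {ϖ : 𝒪} {G : SchemeOver k} [GrpObj G] {ιG : G ⟶ B.G 1}

omit [CommRing 𝒪] [GrpObj G] in
/-- The points of the `[ϖ]`-layer are KILLED BY `β ϖ`: `(g ≫ ιG) ≫ β(ϖ)₁ = 1` (the socket `hker` at `t := g ≫ ιG`). [cite: Tate1967, §2.2] -/
theorem comp_ιG_comp_app_eq_one
    (hker : letI := B.grpObj 1; ∀ ⦃T : SchemeOver k⦄ (t : T ⟶ B.G 1), t ≫ (β ϖ).app 1 = 1 ↔ ∃ s : T ⟶ G, s ≫ ιG = t)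
    {T : SchemeOver k} (g : T ⟶ G) :
    letI := B.grpObj 1; (g ≫ ιG) ≫ (β ϖ).app 1 = 1 :=
  (hker (g ≫ ιG)).mpr ⟨g, rfl⟩

omit [GrpObj G] in
/-- … hence killed by the whole MAXIMAL IDEAL of the DVR `𝒪` (`= (ϖ)` for an irreducible `ϖ`, Mathlib `irreducible_iff_uniformizer`):
`x = c·ϖ` acts as `β ϖ` followed by `β c`, and `1 ≫ β(c)₁ = 1`. [cite: Tate1967, §2.2] -/
theorem comp_ιG_comp_app_eq_one_of_mem_maximalIdeal [IsDomain 𝒪] [IsDiscreteValuationRing 𝒪] (hβ : IsRingActionBT B β)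
    (hϖ : Irreducible ϖ)
    (hker : letI := B.grpObj 1; ∀ ⦃T : SchemeOver k⦄ (t : T ⟶ B.G 1), t ≫ (β ϖ).app 1 = 1 ↔ ∃ s : T ⟶ G, s ≫ ιG = t)
    {T : SchemeOver k} (g : T ⟶ G) {x : 𝒪} (hx : x ∈ IsLocalRing.maximalIdeal 𝒪) :
    letI := B.grpObj 1; (g ≫ ιG) ≫ (β x).app 1 = 1 := by
  letI := B.grpObj 1
  rw [(IsDiscreteValuationRing.irreducible_iff_uniformizer ϖ).mp hϖ, Ideal.mem_span_singleton'] at hx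
  obtain ⟨c, rfl⟩ := hx
  rw [comp_app_mul hβ, comp_ιG_comp_app_eq_one hker g]
  haveI := (β c).isMonHom_app 1
  exact MonObj.one_comp _

omit [GrpObj G] in
/-- **THE ACTION FACTORS THROUGH THE RESIDUE FIELD**: if `x, y ∈ 𝒪` have the same residue then `(g ≫ ιG) ≫ β(x)₁ = (g ≫ ιG) ≫ β(y)₁` on every point
`g` of the `[ϖ]`-layer (`x − y ∈ (ϖ)` acts trivially; §1). [cite: Tate1967, §2.2] [cite: HarrisTaylorAMS2001, §II.2] -/
theorem comp_ιG_comp_app_eq_of_residue_eq [IsDomain 𝒪] [IsDiscreteValuationRing 𝒪] (hβ : IsRingActionBT B β) (hϖ : Irreducible ϖ)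
    (hker : letI := B.grpObj 1; ∀ ⦃T : SchemeOver k⦄ (t : T ⟶ B.G 1), t ≫ (β ϖ).app 1 = 1 ↔ ∃ s : T ⟶ G, s ≫ ιG = t)
    {T : SchemeOver k} (g : T ⟶ G) {x y : 𝒪} (hxy : IsLocalRing.residue 𝒪 x = IsLocalRing.residue 𝒪 y) :
    (g ≫ ιG) ≫ (β x).app 1 = (g ≫ ιG) ≫ (β y).app 1 := by
  letI := B.grpObj 1
  have hmem : x - y ∈ IsLocalRing.maximalIdeal 𝒪 := Ideal.Quotient.eq.mp hxy
  have h1 := comp_app_sub hβ (g ≫ ιG) x y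
  rw [comp_ιG_comp_app_eq_one_of_mem_maximalIdeal hβ hϖ hker g hmem] at h1
  exact (mul_inv_eq_one.mp h1.symm)

/-- **A UNIT ACTING TRIVIALLY FORCES THE POINT TO BE TRIVIAL**: if `u ∈ 𝒪ˣ` and `(g ≫ ιG) ≫ β(u)₁ = 1` then `g = 1` (`g ≫ ιG = (g ≫ ιG) ≫ β(u)₁ ≫
β(u⁻¹)₁ = 1 ≫ β(u⁻¹)₁ = 1`, and `ιG` is a monomorphism). [cite: Tate1967, §2.2] [cite: HarrisTaylorAMS2001, §II.2] -/
theorem eq_one_of_isUnit_of_comp_app_eq_one (hβ : IsRingActionBT B β)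
    (hιG : letI := B.grpObj 1; IsMonHom ιG ∧ IsClosedImmersion ιG.left)
    {T : SchemeOver k} (g : T ⟶ G) {u : 𝒪} (hu : IsUnit u)
    (h1 : letI := B.grpObj 1; (g ≫ ιG) ≫ (β u).app 1 = 1) : g = 1 := by
  letI := B.grpObj 1
  haveI : IsMonHom ιG := hιG.1
  haveI : IsClosedImmersion ιG.left := hιG.2
  haveI : Mono ιG := Over.mono_of_mono_left ιG
  obtain ⟨u, rfl⟩ := hu
  have h2 : (g ≫ ιG) ≫ (β ((↑u⁻¹ : 𝒪) * ↑u)).app 1 = g ≫ ιG := by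
    rw [Units.inv_mul, comp_app_one hβ]
  rw [comp_app_mul hβ, h1] at h2
  haveI := (β (↑u⁻¹ : 𝒪)).isMonHom_app 1
  rw [MonObj.one_comp] at h2
  have h3 : g ≫ ιG = (1 : T ⟶ G) ≫ ιG := by
    rw [MonObj.one_comp]
    exact h2.symm
  exact (cancel_mono ιG).mp h3

end Layer

/-! ## §3 The stable subgroups of `G(k)` are `⊥` and `⊤` -/

/-- **`stub_N6_simplePoints` — THE `β`-STABLE SUBGROUPS OF `G(k)` ARE `⊥, ⊤`.**  For a closed subgroup `ιG : G ↪ B.G 1` of the first layer of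
a Barsotti–Tate group `B` over a field `k` with a ring action `β` of a LOCAL ring `𝒪` (residue field of cardinality `p^f`), an action socket
`βG : σO → End G` lifting `β ∘ ρ` along `ιG` with the residues of the `ρ a` exhausting the residue field, and `#G(k) ∈ {1, p^f}`: every subgroup
`Λ ⊆ G(k) = Hom(𝟙_, G)` stable under all `βG a` is `⊥` or `⊤`.  (The stub's binders `ϖ`, `hϖ : Irreducible ϖ`, `hker` — «`G` is the `[ϖ]`-layer» —
and `IsDiscreteValuationRing 𝒪` are NOT needed: pay it by `exact subgroup_eq_bot_or_eq_top_of_stable p f 𝒪 B β hβ hq G ιG hιG ρ hρ βG hβG hpts`.)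
Proof: if `#G(k) = 1` all subgroups are `⊥`; else pick `g ∈ Λ`, `g ≠ 1` and a section `c ↦ a_c` of the residues of `ρ`; the orbit map
`c ↦ g ≫ βG a_c : κ → G(k)` takes values in `Λ` and is INJECTIVE — if `g ≫ βG a_c = g ≫ βG a_{c'}` then `(g ≫ ιG) ≫ β(ρ a_c − ρ a_{c'})₁ = 1` (§1), so
either the difference is a unit and `g = 1` (`eq_one_of_isUnit_of_comp_app_eq_one`), or it lies in the maximal ideal and `c = c'` — hence
BIJECTIVE as `#κ = p^f = #G(k)`, so `Λ = ⊤`. [cite: HarrisTaylorAMS2001, §II.2] [cite: Liu2021, Prop. D.8 (proof), p. 136] [cite: Tate1967, §2.2] -/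
theorem subgroup_eq_bot_or_eq_top_of_stable (p f : ℕ) [Fact p.Prime] (𝒪 : Type v) [CommRing 𝒪] [IsLocalRing 𝒪]
    {H : ℕ} (B : BTGroup (Spec (.of k)) p H)
    (β : 𝒪 → BTGroup.Hom B B) (hβ : IsRingActionBT B β)
    (hq : Nat.card (IsLocalRing.ResidueField 𝒪) = p ^ f)
    (G : SchemeOver k) [GrpObj G] (ιG : G ⟶ B.G 1)
    (hιG : letI := B.grpObj 1; IsMonHom ιG ∧ IsClosedImmersion ιG.left)
    {σO : Type w} (ρ : σO → 𝒪) (hρ : Function.Surjective fun a => IsLocalRing.residue 𝒪 (ρ a))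
    (βG : σO → (G ⟶ G)) (hβG : ∀ a, βG a ≫ ιG = ιG ≫ (β (ρ a)).app 1)
    (hpts : Nat.card (𝟙_ (SchemeOver k) ⟶ G) = 1 ∨ Nat.card (𝟙_ (SchemeOver k) ⟶ G) = p ^ f) :
    ∀ Λ : Subgroup (𝟙_ (SchemeOver k) ⟶ G), (∀ a, ∀ g ∈ Λ, g ≫ βG a ∈ Λ) → Λ = ⊥ ∨ Λ = ⊤ := by
  classical
  intro Λ hΛ
  letI := B.grpObj 1
  rcases hpts with h1 | hq'
  · -- `#G(k) = 1`: the group of points is trivial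
    left
    haveI : Subsingleton (𝟙_ (SchemeOver k) ⟶ G) := (Nat.card_eq_one_iff_unique.mp h1).1
    exact Λ.eq_bot_of_subsingleton
  · by_cases hbot : ∀ g ∈ Λ, g = 1
    · left
      exact (Subgroup.eq_bot_iff_forall Λ).mpr hbot
    · right
      push Not at hbot
      obtain ⟨g, hgΛ, hg1⟩ := hbot
      have hp : p ^ f ≠ 0 := pow_ne_zero _ (Nat.Prime.ne_zero Fact.out)
      haveI : Finite (𝟙_ (SchemeOver k) ⟶ G) := Nat.finite_of_card_ne_zero (by rw [hq']; exact hp)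
      -- a section of `residue ∘ ρ`
      let s : IsLocalRing.ResidueField 𝒪 → σO := fun c => Classical.choose (hρ c)
      have hs : ∀ c, IsLocalRing.residue 𝒪 (ρ (s c)) = c := fun c => Classical.choose_spec (hρ c)
      -- the orbit map of `g`
      let n : IsLocalRing.ResidueField 𝒪 → (𝟙_ (SchemeOver k) ⟶ G) := fun c => g ≫ βG (s c)
      have hnΛ : ∀ c, n c ∈ Λ := fun c => hΛ (s c) g hgΛ
      have hnι : ∀ c, n c ≫ ιG = (g ≫ ιG) ≫ (β (ρ (s c))).app 1 := fun c => by
        change (g ≫ βG (s c)) ≫ ιG = _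
        rw [Category.assoc, hβG, Category.assoc]
      have hinj : Function.Injective n := by
        intro c c' hcc'
        by_contra hne
        have hu : IsUnit (ρ (s c) - ρ (s c')) := by
          by_contra hnu
          have hmem : ρ (s c) - ρ (s c') ∈ IsLocalRing.maximalIdeal 𝒪 := (IsLocalRing.mem_maximalIdeal _).mpr hnu
          apply hne
          have h := Ideal.Quotient.eq.mpr hmem
          change IsLocalRing.residue 𝒪 (ρ (s c)) = IsLocalRing.residue 𝒪 (ρ (s c')) at h
          rwa [hs, hs] at h
        apply hg1
        refine eq_one_of_isUnit_of_comp_app_eq_one hβ hιG g hu ?_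
        rw [comp_app_sub hβ, ← hnι c, ← hnι c', hcc', mul_inv_cancel]
      have hbij : Function.Bijective n := hinj.bijective_of_nat_card_le (by rw [hq, hq'])
      rw [Subgroup.eq_top_iff']
      intro x
      obtain ⟨c, rfl⟩ := hbij.2 x
      exact hnΛ c

end Literature.AlgebraicGeometry.GroupSchemes.StableSubgroupsOfPoints

end
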